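import Literature.Claims.NS.ClayR3BlowupAlternative
import Literature.Analysis.FluidPDE.NSVorticityBKMHolds
import HarnessLib

/-!
# Clay (A)/(C) reference — the Beale–Kato–Majda forms: (A) ⇔ an a priori bound on the vorticity
# (pointwise sup, or BKM's time integral `∫₀ᵀ ‖ω‖_∞`) of finite-energy classical solutions; a BKM
# blow-up certificate proves (C)

Companion to `ClayR3SupBlowupCertificate.lean` (velocity / gradient / vorticity POINTWISE sup-norm
certificates ⇒ (C)) and `ClayR3BlowupAlternative.lean` ((A) ⇔ a priori `L^∞` bound on the
velocity), using the tree's DISCHARGED Beale–Kato–Majda criterion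
`Literature.Analysis.FluidPDE.beale_kato_majda_holds` (Beale–Kato–Majda 1984 Thm. 1; Majda–Bertozzi
2002 Thm. 3.6: a classical solution on `[0, T)` with all Sobolev norms bounded on every closed
sub-slab continues in that class past `T` iff `∫₀ᵀ ‖curl u(t)‖_∞ dt < ∞`). Since a finite-energy
classical solution from a datum of class (4) IS in the BKM class on every closed sub-slab (Tao 2013
Cor. 11.1, `IsClassicalNSSolutionOn.hasBoundedSobolevNormsOn_of_sobolevDatum_unforced`), the
vorticity takes the place of the velocity in the a priori form of (A):

* `not_clayR3_solvable_of_vorticityIntegralCertificate` / `navierStokesBreakdownR3_of_vorticityIntegralCertificate`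
  — the BKM TIME-INTEGRAL certificate on `ℝ³`: a finite-energy classical solution on `[0, T)` from a
  class-(4) datum with `∫₀ᵀ sup_x |curl u(t,x)| dt = ∞` excludes Clay solvability of the datum, hence
  proves (C) (the `ℝ³` twin of ns-claims-salvage-p5's periodic `ClayPeriodicBlowupCertificate`; only
  the bound `exists_norm_iteratedFDeriv_le_of_claySolution` is needed, not BKM);
* `hasBoundedSobolevNormsOn_Icc_of_finiteEnergy_Ico` — a finite-energy classical solution on
  `[0, T)` from a class-(4) datum has all Sobolev norms bounded on every `[0, T'']`, `T'' < T`;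
* `clayR3_regularityAt_iff_aprioriBKM` / `clayR3_regularity_iff_aprioriBKM(_at)` — **(A) ⇔ every
  finite-energy classical solution on a half-open slab `[0, T)` from a smooth divergence-free
  class-(4) datum has `∫₀ᵀ ‖curl u(t)‖_∞ dt < ∞`** ((⇐): by the blow-up alternative
  `clayR3_solvable_or_supBlowup` a non-solvable datum carries a maximal finite-energy classical
  solution on `[0, T*)`; BKM continues it in the Sobolev class past `T*`, and the continuation
  restricted to `[0, T*]` is a finite-energy classical solution on the closed slab — excluded by
  maximality);
* `clayR3_regularityAt_iff_aprioriVorticityBound` / `clayR3_regularity_iff_aprioriVorticityBound(_at)`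
  — the pointwise form: (A) ⇔ every such solution has BOUNDED vorticity on `[0, T) × ℝ³`;
* `exists_bkmBlowup_of_not_clayR3_regularity` — if (A) fails, some finite-energy classical solution
  from a class-(4) datum has `∫₀^{T} ‖ω‖_∞ = ∞` on a finite slab;
* (rev 2) `clayR3_regularityAt_iff_aprioriGradientBound` / `clayR3_regularity_iff_aprioriGradientBound(_at)`
  — (A) ⇔ every such solution has the velocity GRADIENT `‖∇u‖` bounded on `[0, T) × ℝ³`
  (`|curl v| ≤ ‖curlCLM‖ ‖∇v‖`).

Usage on a CARD (§3): a REG claim whose decisive printed sentence is an a priori VORTICITY bound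
(pointwise, or BKM's `L¹_t L^∞_x`) for smooth finite-energy solutions of the unforced problem from
class-(4) data IS (A) by `clayR3_regularity_iff_aprioriVorticityBound` / `…_iff_aprioriBKM` — no Δ6
delta; the deltas that remain are the CLASS over which the bound is printed (Δ4/Δ5: e.g. slice-wise
rapid decay `Lam2019.SlabSolution.decay`, no energy hypothesis, `ν = 0`) and forcing (Δ3).

## References

* J. T. Beale, T. Kato, A. Majda, *Remarks on the breakdown of smooth solutions for the 3-D Euler
  equations*, Comm. Math. Phys. 94 (1984), Thm. 1 and Corollary. [BealeKatoMajda1984]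
* A. J. Majda, A. L. Bertozzi, *Vorticity and Incompressible Flow*, CUP 2002, Thm. 3.6, Cor. 3.2.
  [MajdaBertozziCUP2002]
* C. L. Fefferman, CMI 2006, (A), (C) with (4)–(7) p. 2. [FeffermanClay2006]
* T. Tao, Anal. PDE 6 (2013) = arXiv:1108.1165: Cor. 11.1, Cor. 11.4. [Tao2013Localisation]

WHAT THIS IS NOT: not a claim about NS regularity or blow-up; not a claim about any author beyond
the typed locator.
-/

open scoped ContDiff ENNReal NNReal Topology

namespace Literature.Claims.NS.ClayVariants

open Set Filter MeasureTheory Function Literature.Analysis Literature.Analysis.FluidPDE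

noncomputable section

variable {μ T : ℝ} {u₀ : EuclideanSpace ℝ (Fin 3) → EuclideanSpace ℝ (Fin 3)}
  {u : ℝ → EuclideanSpace ℝ (Fin 3) → EuclideanSpace ℝ (Fin 3)} {p : ℝ → EuclideanSpace ℝ (Fin 3) → ℝ}

/-! ## The BKM time-integral certificate on `ℝ³` -/

/-- **Clay solvability bounds BKM's integral**: if `(μ, 0, u₀)` is Clay-solvable (`μ > 0`, `u₀` a `C¹`
datum of class (4)), then along every finite-energy classical solution on `[0, T) × ℝ³` from `u₀`
the vorticity is bounded, so `∫₀ᵀ sup_x |curl u(t,x)| dt ≤ κ B T < ∞`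
(`exists_bounds_of_clayR3_solvable` with `n = 1`, `|curl v| ≤ ‖curlCLM‖ ‖∇v‖`).
[cite: FeffermanClay2006, (A) with (4) (6) (7) p. 2] [cite: BealeKatoMajda1984, Thm. 1] -/
theorem lintegral_iSup_curl_lt_top_of_clayR3_solvable (hμ : 0 < μ) (hu₀ : ContDiff ℝ 1 u₀)
    (hdec : HasRapidSpatialDecay u₀)
    (hcl : IsClassicalNSSolutionOn (Ico 0 T) μ 0 u p) (hu0 : u 0 = u₀)
    (hE : ∃ A : ℝ≥0∞, A < ⊤ ∧ ∀ t ∈ Ico 0 T, ∫⁻ x, ‖u t x‖ₑ ^ 2 ≤ A)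
    (hsol : clayR3.Solvable μ 0 u₀) :
    (∫⁻ t in Ioo 0 T, ⨆ x, ‖curl (u t) x‖ₑ) < ⊤ := by
  obtain ⟨B, hB⟩ := exists_bounds_of_clayR3_solvable hμ hu₀ hdec hcl hu0 hE hsol 1
  have hB0 : ∀ t ∈ Ico 0 T, ∀ x, ‖curl (u t) x‖ ≤ ‖curlCLM‖ * max B 0 := by
    intro t ht x
    refine (norm_curl_le (u t) x).trans
      (mul_le_mul_of_nonneg_left ?_ (ContinuousLinearMap.opNorm_nonneg curlCLM))
    rw [← norm_iteratedFDeriv_one]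
    exact (hB t ht x).trans (le_max_left _ _)
  have hle : (∫⁻ t in Ioo 0 T, ⨆ x, ‖curl (u t) x‖ₑ) ≤
      ∫⁻ _t in Ioo 0 T, ENNReal.ofReal (‖curlCLM‖ * max B 0) := by
    refine setLIntegral_mono' measurableSet_Ioo fun t ht => iSup_le fun x => ?_
    rw [← ofReal_norm]
    exact ENNReal.ofReal_le_ofReal (hB0 t (Ioo_subset_Ico_self ht) x)
  refine lt_of_le_of_lt hle ?_
  rw [setLIntegral_const]
  exact ENNReal.mul_lt_top ENNReal.ofReal_lt_top (measure_Ioo_lt_top)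

/-- **A BKM time-integral blow-up certificate excludes Clay solvability**: a finite-energy classical
solution on `[0, T) × ℝ³` from a `C¹` datum of class (4) with `∫₀ᵀ sup_x |curl u(t,x)| dt = ∞`
⇒ `(μ, 0, u₀)` has no Clay (A)-class solution. [cite: FeffermanClay2006, (A) (C) with (4)–(7) p. 2] [cite: BealeKatoMajda1984, Thm. 1] -/
theorem not_clayR3_solvable_of_vorticityIntegralCertificate (hμ : 0 < μ) (hu₀ : ContDiff ℝ 1 u₀)
    (hdec : HasRapidSpatialDecay u₀)
    (hcl : IsClassicalNSSolutionOn (Ico 0 T) μ 0 u p) (hu0 : u 0 = u₀)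
    (hE : ∃ A : ℝ≥0∞, A < ⊤ ∧ ∀ t ∈ Ico 0 T, ∫⁻ x, ‖u t x‖ₑ ^ 2 ≤ A)
    (hblow : (∫⁻ t in Ioo 0 T, ⨆ x, ‖curl (u t) x‖ₑ) = ⊤) :
    ¬ clayR3.Solvable μ 0 u₀ := fun hsol =>
  (lintegral_iSup_curl_lt_top_of_clayR3_solvable hμ hu₀ hdec hcl hu0 hE hsol).ne hblow

/-- **One BKM time-integral blow-up certificate at one viscosity `μ > 0` proves Clay (C)** (the `ℝ³`
twin of the periodic `navierStokesBreakdownPeriodic_of_blowupCertificate`).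
[cite: FeffermanClay2006, (C) p. 2] [cite: BealeKatoMajda1984, Thm. 1] -/
theorem navierStokesBreakdownR3_of_vorticityIntegralCertificate (hμ : 0 < μ)
    (hu₀ : ContDiff ℝ ∞ u₀) (hdiv : NSWave0.IsDivFree u₀) (hdec : HasRapidSpatialDecay u₀)
    (hcl : IsClassicalNSSolutionOn (Ico 0 T) μ 0 u p) (hu0 : u 0 = u₀)
    (hE : ∃ A : ℝ≥0∞, A < ⊤ ∧ ∀ t ∈ Ico 0 T, ∫⁻ x, ‖u t x‖ₑ ^ 2 ≤ A)
    (hblow : (∫⁻ t in Ioo 0 T, ⨆ x, ‖curl (u t) x‖ₑ) = ⊤) :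
    Summit.NavierStokesRegularity.NavierStokesRegularity.NavierStokesBreakdownR3 :=
  navierStokesBreakdownR3_of_not_solvable hμ hu₀ hdiv hdec isSmoothOnHalfSpace_zero
    clayR3_force_zero
    (not_clayR3_solvable_of_vorticityIntegralCertificate hμ (hu₀.of_le (by norm_cast)) hdec hcl hu0
      hE hblow)

/-! ## Finite-energy classical solutions are in the BKM class on closed sub-slabs -/

/-- **A finite-energy classical solution on `[0, T)` from a class-(4) datum has all Sobolev norms
bounded on every closed sub-slab `[0, T'']`, `T'' < T`** (Tao 2013 Cor. 11.1 + Thm. 5.4 (iv) on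
`[0, T'']`, tree theorem `IsClassicalNSSolutionOn.hasBoundedSobolevNormsOn_of_sobolevDatum_unforced`;
`T'' ≤ 0` is the datum alone). [cite: Tao2011, Cor. 11.1 + Thm. 5.4 (iv) (arXiv Cor. 68, Thm. 31 (iv))] -/
theorem hasBoundedSobolevNormsOn_Icc_of_finiteEnergy_Ico (hμ : 0 < μ) (hdec : HasRapidSpatialDecay u₀)
    (hcl : IsClassicalNSSolutionOn (Ico 0 T) μ 0 u p) (hu0 : u 0 = u₀)
    (hE : ∃ A : ℝ≥0∞, A < ⊤ ∧ ∀ t ∈ Ico 0 T, ∫⁻ x, ‖u t x‖ₑ ^ 2 ≤ A) :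
    ∀ T'' < T, HasBoundedSobolevNormsOn (Icc 0 T'') u := by
  intro T'' hT''
  have h₀ : ∀ m : ℕ, ∫⁻ x, ‖iteratedFDeriv ℝ m (u 0) x‖ₑ ^ 2 < ⊤ := fun m => by
    rw [hu0]; exact sobolevDatum_of_rapidDecay hdec m
  rcases le_or_gt T'' 0 with hle | hpos
  · -- only the slice `t = 0` (if any)
    intro n
    refine ⟨(∫⁻ x, ‖iteratedFDeriv ℝ n (u 0) x‖ₑ ^ 2).toNNReal, fun t ht => ?_⟩
    have ht0 : t = 0 := le_antisymm (ht.2.trans hle) ht.1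
    rw [ht0, ENNReal.coe_toNNReal (h₀ n).ne]
  · have hcl' : IsClassicalNSSolutionOn (Icc 0 T'') μ 0 u p :=
      hcl.mono (Icc_subset_Ico_right hT'') (uniqueDiffOn_Icc hpos)
    have hE' : ∃ C : ℝ≥0, ∀ t ∈ Icc 0 T'', ∫⁻ x, ‖u t x‖ₑ ^ 2 ≤ C := by
      obtain ⟨A, hA, hb⟩ := hE
      exact ⟨A.toNNReal, fun t ht =>
        (hb t ⟨ht.1, ht.2.trans_lt hT''⟩).trans (ENNReal.coe_toNNReal hA.ne).ge⟩
    exact hcl'.hasBoundedSobolevNormsOn_of_sobolevDatum_unforced hμ hpos hE' h₀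

/-! ## (A) ⇔ the a priori BKM bound -/

/-- **(A) at one viscosity ⇔ the a priori Beale–Kato–Majda bound.** For `μ > 0`:
`clayR3.RegularityAt μ` ⇔ every classical solution of the unforced system on a half-open slab
`[0, T) × ℝ³`, from a smooth divergence-free datum of class (4), with finite energy on `[0, T)`, has
`∫₀ᵀ sup_x |curl u(t,x)| dt < ∞`. ((⇒) `lintegral_iSup_curl_lt_top_of_clayR3_solvable`. (⇐) If a
datum is not solvable, `clayR3_solvable_or_supBlowup` gives a maximal finite-energy classical solution
on `[0, T*)`; it is in the BKM class on closed sub-slabs, so `beale_kato_majda_holds` continues it in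
the Sobolev class past `T*`, and the continuation is a finite-energy classical solution on the CLOSED
slab `[0, T*]` — excluded by maximality.)
[cite: FeffermanClay2006, (A) with (4) (6) (7) p. 2] [cite: BealeKatoMajda1984, Thm. 1 and Corollary] [cite: MajdaBertozziCUP2002, Thm. 3.6] -/
theorem clayR3_regularityAt_iff_aprioriBKM (hμ : 0 < μ) :
    clayR3.RegularityAt μ ↔
      ∀ (u₀ : EuclideanSpace ℝ (Fin 3) → EuclideanSpace ℝ (Fin 3)), ContDiff ℝ ∞ u₀ →
        NSWave0.IsDivFree u₀ → HasRapidSpatialDecay u₀ →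
        ∀ (T : ℝ) (u : ℝ → EuclideanSpace ℝ (Fin 3) → EuclideanSpace ℝ (Fin 3))
          (p : ℝ → EuclideanSpace ℝ (Fin 3) → ℝ),
          IsClassicalNSSolutionOn (Ico 0 T) μ 0 u p → u 0 = u₀ →
          (∃ A : ℝ≥0∞, A < ⊤ ∧ ∀ t ∈ Ico 0 T, ∫⁻ x, ‖u t x‖ₑ ^ 2 ≤ A) →
            (∫⁻ t in Ioo 0 T, ⨆ x, ‖curl (u t) x‖ₑ) < ⊤ := by
  constructor
  · intro hreg u₀ hu₀ hdiv hdec T u p hcl hu0 hE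
    exact lintegral_iSup_curl_lt_top_of_clayR3_solvable hμ (hu₀.of_le (by norm_cast)) hdec hcl hu0
      hE (hreg u₀ hu₀ hdiv hdec)
  · intro hbkm u₀ hu₀ hdiv hdec
    rcases clayR3_solvable_or_supBlowup hμ hu₀ hdiv hdec with
      hsol | ⟨Ts, hTs, u, p, hcl, hu0, hE, -, hmax⟩
    · exact hsol
    · exfalso
      -- `u` is in the BKM class on closed sub-slabs and its BKM integral is finite: continue it
      have hreg := hasBoundedSobolevNormsOn_Icc_of_finiteEnergy_Ico hμ hdec hcl hu0 hE
      have hfin := hbkm u₀ hu₀ hdiv hdec Ts u p hcl hu0 hE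
      obtain ⟨T', hT', u', p', hcl', hsob', hagr⟩ :=
        (beale_kato_majda_holds hμ.le hTs hcl hreg).2 hfin
      -- the continuation restricted to the CLOSED slab `[0, T*]` is finite-energy classical from `u₀`
      have hcl'' : IsClassicalNSSolutionOn (Icc 0 Ts) μ 0 u' p' :=
        hcl'.mono (Icc_subset_Ico_right hT') (uniqueDiffOn_Icc hTs)
      have hu'0 : u' 0 = u₀ := (hagr 0 ⟨le_rfl, hTs⟩).trans hu0
      obtain ⟨C, hC⟩ := hsob' 0
      refine hmax Ts le_rfl u' p' hcl'' hu'0 ⟨C, ENNReal.coe_lt_top, fun t ht => ?_⟩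
      have h := hC t ht
      have h2 : ∀ x, ‖iteratedFDeriv ℝ 0 (u' t) x‖ₑ = ‖u' t x‖ₑ := fun x =>
        enorm_eq_iff_norm_eq.2 norm_iteratedFDeriv_zero
      simp_rw [h2] at h
      exact h

/-- **(A) ⇔ the a priori BKM bound at every viscosity.**
[cite: FeffermanClay2006, (A) with (4) (6) (7) p. 2] [cite: BealeKatoMajda1984, Thm. 1 and Corollary] -/
theorem clayR3_regularity_iff_aprioriBKM :
    clayR3.Regularity ↔
      ∀ μ : ℝ, 0 < μ →
      ∀ (u₀ : EuclideanSpace ℝ (Fin 3) → EuclideanSpace ℝ (Fin 3)), ContDiff ℝ ∞ u₀ →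
        NSWave0.IsDivFree u₀ → HasRapidSpatialDecay u₀ →
        ∀ (T : ℝ) (u : ℝ → EuclideanSpace ℝ (Fin 3) → EuclideanSpace ℝ (Fin 3))
          (p : ℝ → EuclideanSpace ℝ (Fin 3) → ℝ),
          IsClassicalNSSolutionOn (Ico 0 T) μ 0 u p → u 0 = u₀ →
          (∃ A : ℝ≥0∞, A < ⊤ ∧ ∀ t ∈ Ico 0 T, ∫⁻ x, ‖u t x‖ₑ ^ 2 ≤ A) →
            (∫⁻ t in Ioo 0 T, ⨆ x, ‖curl (u t) x‖ₑ) < ⊤ :=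
  ⟨fun h μ hμ => (clayR3_regularityAt_iff_aprioriBKM hμ).1 (h μ hμ),
    fun h μ hμ => (clayR3_regularityAt_iff_aprioriBKM hμ).2 (h μ hμ)⟩

/-- **(A) ⇔ the a priori BKM bound at ONE viscosity `μ > 0`.**
[cite: FeffermanClay2006, (A) p. 2] [cite: BealeKatoMajda1984, Thm. 1 and Corollary] [cite: Tao2013Localisation, Rem. 1.2 footnote] -/
theorem clayR3_regularity_iff_aprioriBKM_at (hμ : 0 < μ) :
    clayR3.Regularity ↔
      ∀ (u₀ : EuclideanSpace ℝ (Fin 3) → EuclideanSpace ℝ (Fin 3)), ContDiff ℝ ∞ u₀ →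
        NSWave0.IsDivFree u₀ → HasRapidSpatialDecay u₀ →
        ∀ (T : ℝ) (u : ℝ → EuclideanSpace ℝ (Fin 3) → EuclideanSpace ℝ (Fin 3))
          (p : ℝ → EuclideanSpace ℝ (Fin 3) → ℝ),
          IsClassicalNSSolutionOn (Ico 0 T) μ 0 u p → u 0 = u₀ →
          (∃ A : ℝ≥0∞, A < ⊤ ∧ ∀ t ∈ Ico 0 T, ∫⁻ x, ‖u t x‖ₑ ^ 2 ≤ A) →
            (∫⁻ t in Ioo 0 T, ⨆ x, ‖curl (u t) x‖ₑ) < ⊤ := by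
  rw [← clayR3_regularityAt_iff hμ]
  exact clayR3_regularityAt_iff_aprioriBKM hμ

/-! ## (A) ⇔ the a priori pointwise vorticity bound -/

/-- **(A) at one viscosity ⇔ the a priori POINTWISE vorticity bound**: `clayR3.RegularityAt μ` ⇔
every finite-energy classical solution on a half-open slab `[0, T) × ℝ³` from a smooth
divergence-free class-(4) datum has `|curl u|` BOUNDED on `[0, T) × ℝ³` ((⇒) from the derivative
bounds of a Clay solution; (⇐) a pointwise bound `M` gives the BKM integral `≤ M T < ∞`).
[cite: FeffermanClay2006, (A) with (4) (6) (7) p. 2] [cite: BealeKatoMajda1984, Thm. 1 and Corollary] -/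
theorem clayR3_regularityAt_iff_aprioriVorticityBound (hμ : 0 < μ) :
    clayR3.RegularityAt μ ↔
      ∀ (u₀ : EuclideanSpace ℝ (Fin 3) → EuclideanSpace ℝ (Fin 3)), ContDiff ℝ ∞ u₀ →
        NSWave0.IsDivFree u₀ → HasRapidSpatialDecay u₀ →
        ∀ (T : ℝ) (u : ℝ → EuclideanSpace ℝ (Fin 3) → EuclideanSpace ℝ (Fin 3))
          (p : ℝ → EuclideanSpace ℝ (Fin 3) → ℝ),
          IsClassicalNSSolutionOn (Ico 0 T) μ 0 u p → u 0 = u₀ →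
          (∃ A : ℝ≥0∞, A < ⊤ ∧ ∀ t ∈ Ico 0 T, ∫⁻ x, ‖u t x‖ₑ ^ 2 ≤ A) →
            ∃ M : ℝ, ∀ t ∈ Ico 0 T, ∀ x, ‖curl (u t) x‖ ≤ M := by
  constructor
  · intro hreg u₀ hu₀ hdiv hdec T u p hcl hu0 hE
    obtain ⟨B, hB⟩ := exists_bounds_of_clayR3_solvable hμ (hu₀.of_le (by norm_cast)) hdec hcl hu0
      hE (hreg u₀ hu₀ hdiv hdec) 1
    refine ⟨‖curlCLM‖ * max B 0, fun t ht x => ?_⟩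
    refine (norm_curl_le (u t) x).trans
      (mul_le_mul_of_nonneg_left ?_ (ContinuousLinearMap.opNorm_nonneg curlCLM))
    rw [← norm_iteratedFDeriv_one]
    exact (hB t ht x).trans (le_max_left _ _)
  · intro hbd
    refine (clayR3_regularityAt_iff_aprioriBKM hμ).2 fun u₀ hu₀ hdiv hdec T u p hcl hu0 hE => ?_
    obtain ⟨M, hM⟩ := hbd u₀ hu₀ hdiv hdec T u p hcl hu0 hE
    have hle : (∫⁻ t in Ioo 0 T, ⨆ x, ‖curl (u t) x‖ₑ) ≤
        ∫⁻ _t in Ioo 0 T, ENNReal.ofReal M := by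
      refine setLIntegral_mono' measurableSet_Ioo fun t ht => iSup_le fun x => ?_
      rw [← ofReal_norm]
      exact ENNReal.ofReal_le_ofReal (hM t (Ioo_subset_Ico_self ht) x)
    refine lt_of_le_of_lt hle ?_
    rw [setLIntegral_const]
    exact ENNReal.mul_lt_top ENNReal.ofReal_lt_top measure_Ioo_lt_top

/-- **(A) ⇔ the a priori pointwise vorticity bound at every viscosity.**
[cite: FeffermanClay2006, (A) with (4) (6) (7) p. 2] [cite: BealeKatoMajda1984, Thm. 1 and Corollary] -/
theorem clayR3_regularity_iff_aprioriVorticityBound :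
    clayR3.Regularity ↔
      ∀ μ : ℝ, 0 < μ →
      ∀ (u₀ : EuclideanSpace ℝ (Fin 3) → EuclideanSpace ℝ (Fin 3)), ContDiff ℝ ∞ u₀ →
        NSWave0.IsDivFree u₀ → HasRapidSpatialDecay u₀ →
        ∀ (T : ℝ) (u : ℝ → EuclideanSpace ℝ (Fin 3) → EuclideanSpace ℝ (Fin 3))
          (p : ℝ → EuclideanSpace ℝ (Fin 3) → ℝ),
          IsClassicalNSSolutionOn (Ico 0 T) μ 0 u p → u 0 = u₀ →
          (∃ A : ℝ≥0∞, A < ⊤ ∧ ∀ t ∈ Ico 0 T, ∫⁻ x, ‖u t x‖ₑ ^ 2 ≤ A) →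
            ∃ M : ℝ, ∀ t ∈ Ico 0 T, ∀ x, ‖curl (u t) x‖ ≤ M :=
  ⟨fun h μ hμ => (clayR3_regularityAt_iff_aprioriVorticityBound hμ).1 (h μ hμ),
    fun h μ hμ => (clayR3_regularityAt_iff_aprioriVorticityBound hμ).2 (h μ hμ)⟩

/-- **(A) ⇔ the a priori pointwise vorticity bound at ONE viscosity `μ > 0`.**
[cite: FeffermanClay2006, (A) p. 2] [cite: BealeKatoMajda1984, Thm. 1 and Corollary] [cite: Tao2013Localisation, Rem. 1.2 footnote] -/
theorem clayR3_regularity_iff_aprioriVorticityBound_at (hμ : 0 < μ) :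
    clayR3.Regularity ↔
      ∀ (u₀ : EuclideanSpace ℝ (Fin 3) → EuclideanSpace ℝ (Fin 3)), ContDiff ℝ ∞ u₀ →
        NSWave0.IsDivFree u₀ → HasRapidSpatialDecay u₀ →
        ∀ (T : ℝ) (u : ℝ → EuclideanSpace ℝ (Fin 3) → EuclideanSpace ℝ (Fin 3))
          (p : ℝ → EuclideanSpace ℝ (Fin 3) → ℝ),
          IsClassicalNSSolutionOn (Ico 0 T) μ 0 u p → u 0 = u₀ →
          (∃ A : ℝ≥0∞, A < ⊤ ∧ ∀ t ∈ Ico 0 T, ∫⁻ x, ‖u t x‖ₑ ^ 2 ≤ A) →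
            ∃ M : ℝ, ∀ t ∈ Ico 0 T, ∀ x, ‖curl (u t) x‖ ≤ M := by
  rw [← clayR3_regularityAt_iff hμ]
  exact clayR3_regularityAt_iff_aprioriVorticityBound hμ

/-- **If (A) fails, it fails through a BKM blow-up**: `¬ clayR3.Regularity` ⇒ some finite-energy
classical solution on a half-open slab `[0, T)`, `T > 0`, from a smooth divergence-free class-(4)
datum, at some viscosity `μ > 0`, has `∫₀ᵀ sup_x |curl u| dt = ∞`.
[cite: FeffermanClay2006, (A) (C) p. 2] [cite: BealeKatoMajda1984, Thm. 1] -/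
theorem exists_bkmBlowup_of_not_clayR3_regularity (h : ¬ clayR3.Regularity) :
    ∃ μ : ℝ, 0 < μ ∧ ∃ u₀ : EuclideanSpace ℝ (Fin 3) → EuclideanSpace ℝ (Fin 3),
      ContDiff ℝ ∞ u₀ ∧ NSWave0.IsDivFree u₀ ∧ HasRapidSpatialDecay u₀ ∧
      ∃ (T : ℝ) (u : ℝ → EuclideanSpace ℝ (Fin 3) → EuclideanSpace ℝ (Fin 3))
        (p : ℝ → EuclideanSpace ℝ (Fin 3) → ℝ),
        IsClassicalNSSolutionOn (Ico 0 T) μ 0 u p ∧ u 0 = u₀ ∧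
        (∃ A : ℝ≥0∞, A < ⊤ ∧ ∀ t ∈ Ico 0 T, ∫⁻ x, ‖u t x‖ₑ ^ 2 ≤ A) ∧
        (∫⁻ t in Ioo 0 T, ⨆ x, ‖curl (u t) x‖ₑ) = ⊤ := by
  rw [clayR3_regularity_iff_aprioriBKM] at h
  push Not at h
  obtain ⟨μ, hμ, u₀, hu₀, hdiv, hdec, T, u, p, hcl, hu0, hE, htop⟩ := h
  exact ⟨μ, hμ, u₀, hu₀, hdiv, hdec, T, u, p, hcl, hu0, hE, top_le_iff.1 htop⟩

/-! ## (A) ⇔ the a priori GRADIENT sup bound (rev 2, lit-4 g5) -/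

/-- **(A) at one viscosity ⇔ the a priori pointwise GRADIENT bound** (`μ > 0`): `clayR3.RegularityAt μ` ⇔
every classical solution of the unforced system on a half-open slab `[0, T) × ℝ³`, from a smooth
divergence-free datum of class (4), with finite energy on `[0, T)`, has `‖∇u‖` BOUNDED on `[0, T) × ℝ³`
((⇒) `exists_bounds_of_clayR3_solvable` with `n = 1`; (⇐) a gradient bound `D` is a vorticity bound
`‖curlCLM‖ D`, `clayR3_regularityAt_iff_aprioriVorticityBound`).
[cite: FeffermanClay2006, (A) with (4) (6) (7) p. 2] [cite: BealeKatoMajda1984, Thm. 1 and Corollary] -/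
theorem clayR3_regularityAt_iff_aprioriGradientBound (hμ : 0 < μ) :
    clayR3.RegularityAt μ ↔
      ∀ (u₀ : EuclideanSpace ℝ (Fin 3) → EuclideanSpace ℝ (Fin 3)), ContDiff ℝ ∞ u₀ →
        NSWave0.IsDivFree u₀ → HasRapidSpatialDecay u₀ →
        ∀ (T : ℝ) (u : ℝ → EuclideanSpace ℝ (Fin 3) → EuclideanSpace ℝ (Fin 3))
          (p : ℝ → EuclideanSpace ℝ (Fin 3) → ℝ),
          IsClassicalNSSolutionOn (Ico 0 T) μ 0 u p → u 0 = u₀ →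
          (∃ A : ℝ≥0∞, A < ⊤ ∧ ∀ t ∈ Ico 0 T, ∫⁻ x, ‖u t x‖ₑ ^ 2 ≤ A) →
            ∃ D : ℝ, ∀ t ∈ Ico 0 T, ∀ x, ‖fderiv ℝ (u t) x‖ ≤ D := by
  constructor
  · intro hreg u₀ hu₀ hdiv hdec T u p hcl hu0 hE
    obtain ⟨B, hB⟩ := exists_bounds_of_clayR3_solvable hμ (hu₀.of_le (by norm_cast)) hdec hcl hu0
      hE (hreg u₀ hu₀ hdiv hdec) 1
    exact ⟨B, fun t ht x => by rw [← norm_iteratedFDeriv_one]; exact hB t ht x⟩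
  · intro hbd
    refine (clayR3_regularityAt_iff_aprioriVorticityBound hμ).2
      fun u₀ hu₀ hdiv hdec T u p hcl hu0 hE => ?_
    obtain ⟨D, hD⟩ := hbd u₀ hu₀ hdiv hdec T u p hcl hu0 hE
    refine ⟨‖curlCLM‖ * D, fun t ht x => (norm_curl_le (u t) x).trans ?_⟩
    exact mul_le_mul_of_nonneg_left (hD t ht x) (ContinuousLinearMap.opNorm_nonneg curlCLM)

/-- **(A) ⇔ the a priori pointwise gradient bound at every viscosity.**
[cite: FeffermanClay2006, (A) with (4) (6) (7) p. 2] [cite: BealeKatoMajda1984, Thm. 1 and Corollary] -/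
theorem clayR3_regularity_iff_aprioriGradientBound :
    clayR3.Regularity ↔
      ∀ μ : ℝ, 0 < μ →
      ∀ (u₀ : EuclideanSpace ℝ (Fin 3) → EuclideanSpace ℝ (Fin 3)), ContDiff ℝ ∞ u₀ →
        NSWave0.IsDivFree u₀ → HasRapidSpatialDecay u₀ →
        ∀ (T : ℝ) (u : ℝ → EuclideanSpace ℝ (Fin 3) → EuclideanSpace ℝ (Fin 3))
          (p : ℝ → EuclideanSpace ℝ (Fin 3) → ℝ),
          IsClassicalNSSolutionOn (Ico 0 T) μ 0 u p → u 0 = u₀ →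
          (∃ A : ℝ≥0∞, A < ⊤ ∧ ∀ t ∈ Ico 0 T, ∫⁻ x, ‖u t x‖ₑ ^ 2 ≤ A) →
            ∃ D : ℝ, ∀ t ∈ Ico 0 T, ∀ x, ‖fderiv ℝ (u t) x‖ ≤ D :=
  ⟨fun h μ hμ => (clayR3_regularityAt_iff_aprioriGradientBound hμ).1 (h μ hμ),
    fun h μ hμ => (clayR3_regularityAt_iff_aprioriGradientBound hμ).2 (h μ hμ)⟩

/-- **(A) ⇔ the a priori pointwise gradient bound at ONE viscosity `μ > 0`.**
[cite: FeffermanClay2006, (A) p. 2] [cite: Tao2013Localisation, Rem. 1.2 footnote] -/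
theorem clayR3_regularity_iff_aprioriGradientBound_at (hμ : 0 < μ) :
    clayR3.Regularity ↔
      ∀ (u₀ : EuclideanSpace ℝ (Fin 3) → EuclideanSpace ℝ (Fin 3)), ContDiff ℝ ∞ u₀ →
        NSWave0.IsDivFree u₀ → HasRapidSpatialDecay u₀ →
        ∀ (T : ℝ) (u : ℝ → EuclideanSpace ℝ (Fin 3) → EuclideanSpace ℝ (Fin 3))
          (p : ℝ → EuclideanSpace ℝ (Fin 3) → ℝ),
          IsClassicalNSSolutionOn (Ico 0 T) μ 0 u p → u 0 = u₀ →
          (∃ A : ℝ≥0∞, A < ⊤ ∧ ∀ t ∈ Ico 0 T, ∫⁻ x, ‖u t x‖ₑ ^ 2 ≤ A) →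
            ∃ D : ℝ, ∀ t ∈ Ico 0 T, ∀ x, ‖fderiv ℝ (u t) x‖ ≤ D := by
  rw [← clayR3_regularityAt_iff hμ]
  exact clayR3_regularityAt_iff_aprioriGradientBound hμ

end

end Literature.Claims.NS.ClayVariants

-- WHAT THIS IS NOT: not a claim about NS regularity or blow-up; not a claim about any author beyond
-- the typed locator.
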